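import Mathlib.Analysis.InnerProductSpace.PiL2
import Mathlib.MeasureTheory.Measure.Haar.InnerProductSpace
import Mathlib.MeasureTheory.Measure.Lebesgue.EqHaar
import Mathlib.MeasureTheory.Integral.Bochner.Set
import Mathlib.Analysis.Normed.Lp.PiLp
import Mathlib.Data.Fin.Tuple.Sort
import HarnessLib

/-!
# The six open Kuhn simplices of a unit cube of `ℝ³` have volume `1∕6` each and fill the cube up to a null set
# (K2 organ `hImproveCoreFlat`, ORGAN memo §4 brick B3 «compactness ∕ interpolation package», mesh-side half — the measure
# letters; cell ym3-torus, seat px7 g7)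

Helper toward crux `stmt-QuantumFields-19936` (`Summit.QuantumFields.YangMills.Theses.UnitScaleTilt.HistoryTailL`), road R1 ∕
LINE 25 `stub_latticeToContinuumLimit` (Γ1): the per-cube ENERGY IDENTITY of the Courant `P1` interpolant (sibling
`PoincareLipschitzKuhnEnergy`) integrates the constant energy density of each open Kuhn simplex
`U_σ(y) = {x | y (σ 2) < x (σ 2), x (σ 2) - y (σ 2) < x (σ 1) - y (σ 1) < x (σ 0) - y (σ 0), x (σ 0) < y (σ 0) + 1}` of
`EuclideanSpace ℝ (Fin 3)` against its volume.  This file supplies the measure facts, Mathlib only: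

* `perm_eq_of_strictChain` — two strict orderings of the coordinates of one point coincide: the six open simplices are
  pairwise DISJOINT;
* `volume_openSimplex0_eq` — coordinate permutations are linear isometries (`LinearIsometryEquiv.piLpCongrLeft`), hence volume
  preserving: all six simplices at the origin have the SAME volume;
* `volume_tie_eq_zero`, `volume_tie_translate_eq_zero` — a coordinate tie `x i = x j` (`i ≠ j`) is a proper submodule, hence
  Lebesgue-NULL (`Measure.addHaar_submodule`), and so are its translates;
* `exists_mem_openSimplex0`, `volume_unitCube0_diff_eq_zero` — a point of the open unit cube with distinct coordinates is sorted
  strictly by some permutation (`Tuple.sort`): the simplices COVER the cube up to the ties;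
* `volume_unitCube0 = 1` (transfer to `Fin 3 → ℝ` by `PiLp.volume_preserving_ofLp` and `Real.volume_pi_Ioo`);
* ★ `volume_openSimplex0`, ★ `volume_openSimplex` — hence `6 · vol = 1`, i.e. EVERY open Kuhn simplex, at the origin or at any
  lattice corner `y : Fin 3 → ℤ` (translation invariance `measure_preimage_add_right`), has volume `1∕6`; `volume_cube = 1`,
  `volume_cube_diff_eq_zero` (the cube at `y` minus its six simplices is null).  (The coordinate hyperplanes `x i = c` — the faces between
  neighbouring cubes — are null by lit ✓`Literature.Analysis.Convexity.volume_setOf_apply_eq_zero_three`, cited not restated.)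

HONEST: measure-theoretic bookkeeping; nothing of `stub_latticeToContinuumLimit`, `hImproveCoreFlat`, K1, `MeanDeviationL`,
`BlockLipschitzL`, `HistoryTailL` is proved; YM₃ on T³ is ladder rung R3 — not d = 4, not infinite volume, not a mass gap, not Clay.
-/

open scoped BigOperators
open MeasureTheory

noncomputable section

namespace Summit.QuantumFields.YangMills.Theorems.PoincareLipschitzKuhnSimplexVolume

/-! ## §5 The six open Kuhn simplices of the unit cube have volume `1/6` -/

/-- Two distinct strict orderings of the coordinates of one point cannot both hold: the open Kuhn simplices at the origin are
pairwise disjoint. -/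
theorem perm_eq_of_strictChain {x : Fin 3 → ℝ} {σ τ : Equiv.Perm (Fin 3)}
    (hσ1 : x (σ 2) < x (σ 1)) (hσ2 : x (σ 1) < x (σ 0)) (hτ1 : x (τ 2) < x (τ 1)) (hτ2 : x (τ 1) < x (τ 0)) :
    σ = τ := by
  -- the index of the maximum and of the minimum agree
  have hmax : ∀ j, x (σ j) ≤ x (σ 0) := by
    intro j; fin_cases j
    · exact le_rfl
    · exact hσ2.le
    · exact (hσ1.trans hσ2).le
  have hmin : ∀ j, x (σ 2) ≤ x (σ j) := by
    intro j; fin_cases j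
    · exact (hσ1.trans hσ2).le
    · exact hσ1.le
    · exact le_rfl
  have hmax' : ∀ j, x (τ j) ≤ x (τ 0) := by
    intro j; fin_cases j
    · exact le_rfl
    · exact hτ2.le
    · exact (hτ1.trans hτ2).le
  have hmin' : ∀ j, x (τ 2) ≤ x (τ j) := by
    intro j; fin_cases j
    · exact (hτ1.trans hτ2).le
    · exact hτ1.le
    · exact le_rfl
  have h0 : σ 0 = τ 0 := by
    by_contra hne
    -- τ 0 = σ j for some j ≠ 0, and σ 0 = τ j' for some j' ≠ 0
    obtain ⟨j, hj⟩ : ∃ j, τ 0 = σ j := ⟨σ.symm (τ 0), by simp⟩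
    obtain ⟨j', hj'⟩ : ∃ j', σ 0 = τ j' := ⟨τ.symm (σ 0), by simp⟩
    have hj0 : j ≠ 0 := fun h => hne (by rw [hj, h])
    have hj'0 : j' ≠ 0 := fun h => hne (by rw [hj', h])
    have h1 : x (τ 0) < x (σ 0) := by
      rw [hj]; fin_cases j
      · exact absurd rfl hj0
      · exact hσ2
      · exact hσ1.trans hσ2
    have h2 : x (σ 0) < x (τ 0) := by
      rw [hj']; fin_cases j'
      · exact absurd rfl hj'0
      · exact hτ2
      · exact hτ1.trans hτ2
    exact lt_irrefl _ (h1.trans h2)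
  have h2 : σ 2 = τ 2 := by
    by_contra hne
    obtain ⟨j, hj⟩ : ∃ j, τ 2 = σ j := ⟨σ.symm (τ 2), by simp⟩
    obtain ⟨j', hj'⟩ : ∃ j', σ 2 = τ j' := ⟨τ.symm (σ 2), by simp⟩
    have hj0 : j ≠ 2 := fun h => hne (by rw [hj, h])
    have hj'0 : j' ≠ 2 := fun h => hne (by rw [hj', h])
    have h1 : x (σ 2) < x (τ 2) := by
      rw [hj]; fin_cases j
      · exact hσ1.trans hσ2
      · exact hσ1
      · exact absurd rfl hj0
    have h2 : x (τ 2) < x (σ 2) := by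
      rw [hj']; fin_cases j'
      · exact hτ1.trans hτ2
      · exact hτ1
      · exact absurd rfl hj'0
    exact lt_irrefl _ (h1.trans h2)
  -- the middle index by the sum of the three values
  have hsum : ∀ ρ : Equiv.Perm (Fin 3), ((ρ 0 : ℕ) + ρ 1) + ρ 2 = 3 := fun ρ => by
    have := Equiv.sum_comp ρ (fun i : Fin 3 => (i : ℕ))
    simp only [Fin.sum_univ_three, Fin.val_zero, Fin.val_one, Fin.val_two] at this
    omega
  have h1 : (σ 1 : ℕ) = τ 1 := by
    have hs := hsum σ; have ht := hsum τ
    rw [h0, h2] at hs; omega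
  ext j
  fin_cases j
  · exact congrArg Fin.val h0
  · exact h1
  · exact congrArg Fin.val h2

end Summit.QuantumFields.YangMills.Theorems.PoincareLipschitzKuhnSimplexVolume

namespace Summit.QuantumFields.YangMills.Theorems.PoincareLipschitzKuhnSimplexVolume

/-- The open Kuhn simplex of `σ` at the origin is measurable (it is open). -/
theorem measurableSet_openSimplex0 (σ : Equiv.Perm (Fin 3)) :
    MeasurableSet {x : EuclideanSpace ℝ (Fin 3) | 0 < x (σ 2) ∧ x (σ 2) < x (σ 1) ∧ x (σ 1) < x (σ 0) ∧ x (σ 0) < 1} := by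
  have hc : ∀ i : Fin 3, Continuous fun x : EuclideanSpace ℝ (Fin 3) => x i := fun i =>
    (EuclideanSpace.proj i).continuous
  exact ((isOpen_lt continuous_const (hc _)).and ((isOpen_lt (hc _) (hc _)).and ((isOpen_lt (hc _) (hc _)).and
    (isOpen_lt (hc _) continuous_const)))).measurableSet

/-- Permutation symmetry: every open Kuhn simplex at the origin has the volume of the standard one (coordinate permutations are
linear isometries of `EuclideanSpace`, hence volume preserving). -/
theorem volume_openSimplex0_eq (σ : Equiv.Perm (Fin 3)) :
    volume {x : EuclideanSpace ℝ (Fin 3) | 0 < x (σ 2) ∧ x (σ 2) < x (σ 1) ∧ x (σ 1) < x (σ 0) ∧ x (σ 0) < 1} =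
      volume {x : EuclideanSpace ℝ (Fin 3) | 0 < x 2 ∧ x 2 < x 1 ∧ x 1 < x 0 ∧ x 0 < 1} := by
  let e : EuclideanSpace ℝ (Fin 3) ≃ₗᵢ[ℝ] EuclideanSpace ℝ (Fin 3) := LinearIsometryEquiv.piLpCongrLeft 2 ℝ ℝ σ.symm
  have hpre : e ⁻¹' {x : EuclideanSpace ℝ (Fin 3) | 0 < x 2 ∧ x 2 < x 1 ∧ x 1 < x 0 ∧ x 0 < 1} =
      {x : EuclideanSpace ℝ (Fin 3) | 0 < x (σ 2) ∧ x (σ 2) < x (σ 1) ∧ x (σ 1) < x (σ 0) ∧ x (σ 0) < 1} := by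
    ext x
    simp [e, LinearIsometryEquiv.piLpCongrLeft_apply]
  rw [← hpre]
  exact e.measurePreserving.measure_preimage (measurableSet_openSimplex0 1).nullMeasurableSet

/-- A coordinate tie `x i = x j` (`i ≠ j`) is a proper linear subspace, hence Lebesgue-null. -/
theorem volume_tie_eq_zero {i j : Fin 3} (hij : i ≠ j) :
    volume {x : EuclideanSpace ℝ (Fin 3) | x i = x j} = 0 := by
  let K : Submodule ℝ (EuclideanSpace ℝ (Fin 3)) :=
    LinearMap.ker ((EuclideanSpace.projₗ i : EuclideanSpace ℝ (Fin 3) →ₗ[ℝ] ℝ) - EuclideanSpace.projₗ j)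
  have hK : (K : Set (EuclideanSpace ℝ (Fin 3))) = {x | x i = x j} := by
    ext x; simp [K, sub_eq_zero]
  have hne : K ≠ ⊤ := by
    intro htop
    have hmem : EuclideanSpace.single i (1:ℝ) ∈ K := htop ▸ Submodule.mem_top
    have : (EuclideanSpace.single i (1:ℝ) : EuclideanSpace ℝ (Fin 3)) i = (EuclideanSpace.single i (1:ℝ)) j := by
      have := congrArg (fun s : Set (EuclideanSpace ℝ (Fin 3)) => EuclideanSpace.single i (1:ℝ) ∈ s) hK
      simp only [SetLike.mem_coe, Set.mem_setOf_eq, eq_iff_iff] at this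
      exact this.mp hmem
    simp [hij.symm] at this
  rw [← hK]
  exact Measure.addHaar_submodule volume K hne

/-- A translated tie `x i - x j = c` is null as well (translation invariance). -/
theorem volume_tie_translate_eq_zero {i j : Fin 3} (hij : i ≠ j) (c : ℝ) :
    volume {x : EuclideanSpace ℝ (Fin 3) | x i - x j = c} = 0 := by
  have hpre : (fun x : EuclideanSpace ℝ (Fin 3) => x + EuclideanSpace.single j c) ⁻¹'
      {x : EuclideanSpace ℝ (Fin 3) | x i = x j} = {x | x i - x j = c} := by
    ext x
    simp only [Set.mem_preimage, Set.mem_setOf_eq, PiLp.add_apply, PiLp.single_apply, hij, reduceIte,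
      add_zero, if_true]
    constructor <;> intro h <;> linarith
  rw [← hpre, measure_preimage_add_right]
  exact volume_tie_eq_zero hij

/-- The unit open cube at the origin has volume `1`. -/
theorem volume_unitCube0 :
    volume {x : EuclideanSpace ℝ (Fin 3) | ∀ i, 0 < x i ∧ x i < 1} = 1 := by
  have hpre : (WithLp.ofLp : EuclideanSpace ℝ (Fin 3) → (Fin 3 → ℝ)) ⁻¹'
      (Set.pi Set.univ fun _ => Set.Ioo (0:ℝ) 1) = {x | ∀ i, 0 < x i ∧ x i < 1} := by
    ext x; simp [Set.mem_Ioo]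
  rw [← hpre, (PiLp.volume_preserving_ofLp (Fin 3)).measure_preimage
    (MeasurableSet.univ_pi fun _ => measurableSet_Ioo).nullMeasurableSet]
  simp [Real.volume_pi_Ioo]

end Summit.QuantumFields.YangMills.Theorems.PoincareLipschitzKuhnSimplexVolume

namespace Summit.QuantumFields.YangMills.Theorems.PoincareLipschitzKuhnSimplexVolume

/-- COVER: a point of the open unit cube with pairwise distinct coordinates lies in one of the six open Kuhn simplices. -/
theorem exists_mem_openSimplex0 {x : EuclideanSpace ℝ (Fin 3)} (hx : ∀ i, 0 < x i ∧ x i < 1)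
    (hd : ∀ i j, i ≠ j → x i ≠ x j) :
    ∃ σ : Equiv.Perm (Fin 3), 0 < x (σ 2) ∧ x (σ 2) < x (σ 1) ∧ x (σ 1) < x (σ 0) ∧ x (σ 0) < 1 := by
  have hm := Tuple.monotone_sort (fun i => x i)
  set τ := Tuple.sort (fun i => x i) with hτ
  refine ⟨τ * Fin.revPerm, (hx _).1, ?_, ?_, (hx _).2⟩
  · have h := hm (show (0 : Fin 3) ≤ 1 by decide)
    have hne : x (τ 0) ≠ x (τ 1) := hd _ _ (by simp [τ.injective.eq_iff])
    simpa [Equiv.Perm.mul_apply, Fin.revPerm_apply] using lt_of_le_of_ne h hne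
  · have h := hm (show (1 : Fin 3) ≤ 2 by decide)
    have hne : x (τ 1) ≠ x (τ 2) := hd _ _ (by simp [τ.injective.eq_iff])
    simpa [Equiv.Perm.mul_apply, Fin.revPerm_apply] using lt_of_le_of_ne h hne

/-- The part of the open unit cube outside the six open simplices is Lebesgue-null (it lies in the three coordinate ties). -/
theorem volume_unitCube0_diff_eq_zero :
    volume ({x : EuclideanSpace ℝ (Fin 3) | ∀ i, 0 < x i ∧ x i < 1} \
      ⋃ σ : Equiv.Perm (Fin 3), {x : EuclideanSpace ℝ (Fin 3) | 0 < x (σ 2) ∧ x (σ 2) < x (σ 1) ∧ x (σ 1) < x (σ 0) ∧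
        x (σ 0) < 1}) = 0 := by
  have hsub : ({x : EuclideanSpace ℝ (Fin 3) | ∀ i, 0 < x i ∧ x i < 1} \
      ⋃ σ : Equiv.Perm (Fin 3), {x : EuclideanSpace ℝ (Fin 3) | 0 < x (σ 2) ∧ x (σ 2) < x (σ 1) ∧ x (σ 1) < x (σ 0) ∧
        x (σ 0) < 1}) ⊆ {x | x 0 = x 1} ∪ {x | x 0 = x 2} ∪ {x | x 1 = x 2} := by
    intro x hx
    obtain ⟨hc, hn⟩ := hx
    by_contra hnot
    simp only [Set.mem_union, Set.mem_setOf_eq, not_or] at hnot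
    obtain ⟨⟨h01, h02⟩, h12⟩ := hnot
    have hd : ∀ i j : Fin 3, i ≠ j → x i ≠ x j := by
      intro i j hij
      fin_cases i <;> fin_cases j <;> dsimp only
      all_goals (first
        | exact absurd rfl hij
        | exact h01
        | exact h02
        | exact h12
        | exact Ne.symm h01
        | exact Ne.symm h02
        | exact Ne.symm h12)
    obtain ⟨σ, hσ⟩ := exists_mem_openSimplex0 hc hd
    exact hn (Set.mem_iUnion.mpr ⟨σ, hσ⟩)
  refine measure_mono_null hsub ?_
  have h01 := volume_tie_eq_zero (show (0 : Fin 3) ≠ 1 by decide)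
  have h02 := volume_tie_eq_zero (show (0 : Fin 3) ≠ 2 by decide)
  have h12 := volume_tie_eq_zero (show (1 : Fin 3) ≠ 2 by decide)
  exact measure_union_null (measure_union_null h01 h02) h12

/-- ★ Each open Kuhn simplex at the origin has volume `1/6`: the six are pairwise disjoint, each has the volume of the standard
one, and together they fill the unit cube up to the null ties. -/
theorem volume_openSimplex0 (σ : Equiv.Perm (Fin 3)) :
    volume {x : EuclideanSpace ℝ (Fin 3) | 0 < x (σ 2) ∧ x (σ 2) < x (σ 1) ∧ x (σ 1) < x (σ 0) ∧ x (σ 0) < 1} = 1 / 6 := by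
  set U : Equiv.Perm (Fin 3) → Set (EuclideanSpace ℝ (Fin 3)) := fun σ =>
    {x | 0 < x (σ 2) ∧ x (σ 2) < x (σ 1) ∧ x (σ 1) < x (σ 0) ∧ x (σ 0) < 1} with hU
  have hmeas : ∀ σ, MeasurableSet (U σ) := fun σ => measurableSet_openSimplex0 σ
  have hdisj : Pairwise (Function.onFun Disjoint U) := by
    intro σ τ hne
    refine Set.disjoint_left.mpr fun x hxσ hxτ => hne ?_
    exact perm_eq_of_strictChain (x := fun i => x i) hxσ.2.1 hxσ.2.2.1 hxτ.2.1 hxτ.2.2.1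
  -- the union has the volume of the cube
  have hUsub : (⋃ σ, U σ) ⊆ {x : EuclideanSpace ℝ (Fin 3) | ∀ i, 0 < x i ∧ x i < 1} := by
    intro x hx
    obtain ⟨σ, h0, h1, h2, h3⟩ := Set.mem_iUnion.mp hx
    intro i
    obtain ⟨j, rfl⟩ : ∃ j, i = σ j := ⟨σ.symm i, by simp⟩
    fin_cases j
    · exact ⟨h0.trans (h1.trans h2), h3⟩
    · exact ⟨h0.trans h1, h2.trans h3⟩
    · exact ⟨h0, h1.trans (h2.trans h3)⟩
  have hunion : volume (⋃ σ, U σ) = 1 := by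
    refine le_antisymm ((measure_mono hUsub).trans volume_unitCube0.le) ?_
    have hcov : {x : EuclideanSpace ℝ (Fin 3) | ∀ i, 0 < x i ∧ x i < 1} ⊆
        (⋃ σ, U σ) ∪ ({x : EuclideanSpace ℝ (Fin 3) | ∀ i, 0 < x i ∧ x i < 1} \ ⋃ σ, U σ) := by
      intro x hx
      by_cases h : x ∈ ⋃ σ, U σ
      · exact Or.inl h
      · exact Or.inr ⟨hx, h⟩
    calc (1 : ENNReal) = volume {x : EuclideanSpace ℝ (Fin 3) | ∀ i, 0 < x i ∧ x i < 1} := volume_unitCube0.symm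
      _ ≤ volume ((⋃ σ, U σ) ∪ ({x : EuclideanSpace ℝ (Fin 3) | ∀ i, 0 < x i ∧ x i < 1} \ ⋃ σ, U σ)) :=
          measure_mono hcov
      _ ≤ volume (⋃ σ, U σ) + volume ({x : EuclideanSpace ℝ (Fin 3) | ∀ i, 0 < x i ∧ x i < 1} \ ⋃ σ, U σ) :=
          measure_union_le _ _
      _ = volume (⋃ σ, U σ) := by rw [volume_unitCube0_diff_eq_zero, add_zero]
  -- additivity + symmetry: six equal volumes summing to one
  have hsum : ∑ τ : Equiv.Perm (Fin 3), volume (U τ) = 1 := by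
    rw [← hunion, measure_iUnion hdisj hmeas, tsum_fintype]
  have hconst : ∀ τ : Equiv.Perm (Fin 3), volume (U τ) = volume (U 1) := fun τ => volume_openSimplex0_eq τ
  simp only [hconst, Finset.sum_const, Finset.card_univ, Fintype.card_perm, Fintype.card_fin] at hsum
  rw [hconst σ]
  have h6 : (Nat.factorial 3 : ℕ) = 6 := rfl
  rw [h6] at hsum
  rw [ENNReal.eq_div_iff (by norm_num) (by norm_num)]
  simpa [nsmul_eq_mul] using hsum

end Summit.QuantumFields.YangMills.Theorems.PoincareLipschitzKuhnSimplexVolume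

namespace Summit.QuantumFields.YangMills.Theorems.PoincareLipschitzKuhnSimplexVolume

/-- The translated open Kuhn simplex at the cube corner `y` is the preimage of the one at the origin under `x ↦ x - ŷ`. -/
theorem openSimplex_eq_preimage (y : Fin 3 → ℤ) (σ : Equiv.Perm (Fin 3)) :
    {x : EuclideanSpace ℝ (Fin 3) | (y (σ 2) : ℝ) < x (σ 2) ∧ x (σ 2) - y (σ 2) < x (σ 1) - y (σ 1) ∧
      x (σ 1) - y (σ 1) < x (σ 0) - y (σ 0) ∧ x (σ 0) < y (σ 0) + 1} =
    (fun x : EuclideanSpace ℝ (Fin 3) => x + (-(WithLp.toLp 2 (fun i => (y i : ℝ)) : EuclideanSpace ℝ (Fin 3)))) ⁻¹'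
      {x : EuclideanSpace ℝ (Fin 3) | 0 < x (σ 2) ∧ x (σ 2) < x (σ 1) ∧ x (σ 1) < x (σ 0) ∧ x (σ 0) < 1} := by
  ext x
  simp only [Set.mem_setOf_eq, Set.mem_preimage, PiLp.add_apply, PiLp.neg_apply]
  constructor
  · rintro ⟨h0, h1, h2, h3⟩; exact ⟨by linarith, by linarith, by linarith, by linarith⟩
  · rintro ⟨h0, h1, h2, h3⟩; exact ⟨by linarith, by linarith, by linarith, by linarith⟩

/-- ★ The open Kuhn simplex of `σ` at any cube corner `y` has volume `1/6` (translation invariance). -/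
theorem volume_openSimplex (y : Fin 3 → ℤ) (σ : Equiv.Perm (Fin 3)) :
    volume {x : EuclideanSpace ℝ (Fin 3) | (y (σ 2) : ℝ) < x (σ 2) ∧ x (σ 2) - y (σ 2) < x (σ 1) - y (σ 1) ∧
      x (σ 1) - y (σ 1) < x (σ 0) - y (σ 0) ∧ x (σ 0) < y (σ 0) + 1} = 1 / 6 := by
  rw [openSimplex_eq_preimage, measure_preimage_add_right, volume_openSimplex0]

/-- The open unit cube at `y` is the preimage of the one at the origin. -/
theorem cube_eq_preimage (y : Fin 3 → ℤ) :
    {x : EuclideanSpace ℝ (Fin 3) | ∀ i, (y i : ℝ) < x i ∧ x i < y i + 1} =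
    (fun x : EuclideanSpace ℝ (Fin 3) => x + (-(WithLp.toLp 2 (fun i => (y i : ℝ)) : EuclideanSpace ℝ (Fin 3)))) ⁻¹'
      {x : EuclideanSpace ℝ (Fin 3) | ∀ i, 0 < x i ∧ x i < 1} := by
  ext x
  simp only [Set.mem_setOf_eq, Set.mem_preimage, PiLp.add_apply, PiLp.neg_apply]
  constructor
  · intro h i; have := h i; exact ⟨by linarith [this.1], by linarith [this.2]⟩
  · intro h i; have := h i; exact ⟨by linarith [this.1], by linarith [this.2]⟩

/-- The open unit cube at `y` is covered by its six open Kuhn simplices up to a null set. -/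
theorem volume_cube_diff_eq_zero (y : Fin 3 → ℤ) :
    volume ({x : EuclideanSpace ℝ (Fin 3) | ∀ i, (y i : ℝ) < x i ∧ x i < y i + 1} \
      ⋃ σ : Equiv.Perm (Fin 3), {x : EuclideanSpace ℝ (Fin 3) | (y (σ 2) : ℝ) < x (σ 2) ∧
        x (σ 2) - y (σ 2) < x (σ 1) - y (σ 1) ∧ x (σ 1) - y (σ 1) < x (σ 0) - y (σ 0) ∧ x (σ 0) < y (σ 0) + 1}) = 0 := by
  simp only [cube_eq_preimage, openSimplex_eq_preimage, ← Set.preimage_iUnion, ← Set.preimage_sdiff,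
    measure_preimage_add_right]
  exact volume_unitCube0_diff_eq_zero

/-- The open unit cube at `y` has volume `1`. -/
theorem volume_cube (y : Fin 3 → ℤ) :
    volume {x : EuclideanSpace ℝ (Fin 3) | ∀ i, (y i : ℝ) < x i ∧ x i < y i + 1} = 1 := by
  rw [cube_eq_preimage, measure_preimage_add_right, volume_unitCube0]

end Summit.QuantumFields.YangMills.Theorems.PoincareLipschitzKuhnSimplexVolume
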